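import Summits.QuantumFields.YangMills.Theorems.UnitScaleTiltProp7LemmaHCurvedOfRows
import Summits.QuantumFields.YangMills.Theorems.UnitScaleTiltProp7HermiteCornerDataRow
import HarnessLib

/-!
# Route `UnitScaleTilt`, crux K1 «MinimiserStabilityRegPr» (stmt-QuantumFields-19200), route-R E′ path (α′), row LEMMA-H-CURVED — FILE 6b (T³ letters):
# LEMMA-H-CURVED FROM FRAME ROWS AND A PAIR ROW AT THE CENTRES

Cell `ym3-torus`, D-0154 (3c) twin-width seat `ym-routeR-w1` (gen 5); row "routeR-w1 g5: LEMMA-H-CURVED" (namer ★ym-ust-19200-p1 g14, 2026-08-28 17:33Z; design of record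
(x2′-corner), contract v2 18:49Z).  THEOREMS ONLY (0 `def`, 0 `sorry`); `--supports stmt-QuantumFields-19200`, count-neutral.  YM₃ on T³ is a ladder rung (R3), not the
Clay problem; nothing here claims a stub, the crux, d = 4 or the mass gap.

WHAT.  ✓ `Prop7LemmaHCurvedOfRows.lemmaH_curved_of_rows` (F-H5b) with its data row DISCHARGED by ✓ `Prop7HermiteCornerDataRow.dataRow_lowerCorner` (F-H6) at the lower-corner
recentring: ★★★ `lemmaH_curved_of_pairRow` — if `Δ_W(Δ_Wψ) = 0` off the `(K−n)`-centres then
  `L^(K−n)·Σ_x ‖Δ_Wψ(x)‖²_HS ≤ L^(K−n)·2·{A(a₀,a₁,ℓ,d)·Σ_y ‖ψ(c_y) − c_y‖² + B(ℓ,d)·Σ_y (D_y + 2(dℓ(a₀+a₀))‖ψ(c_y) − c_y‖)²}`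
(`c_y = embIter (K−n) y`; `A`, `B` the explicit constants of F-H5b) for ANY bi-contractive corner frames `Fr_y` normalised at their centres with holonomy rows `a₀ ≥ 0` (size),
`a₁` (backward difference) on the support predicate, ANY central `c_y`, and the displayed PAIR ROW `‖R(Fr_y(c_(y₀))) ψ(c_y) − ψ(c_(y₀))‖ ≤ D_y` for `y − y₀ ∈ {−1,0,1,2}^d`.
The two remaining inputs have named suppliers: the frame rows from (3.35) (routeR-w4's `Prop7ConjFrameReg335` ∘ `ClassTransferT3`), the pair row from the knit's coarse covariant
differences plus the contour-versus-straight holonomy of the (3.35) gauge.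
HONEST SCOPE.  Assembly only; nothing of Bałaban's is asserted; no stub∕crux∕rung statement is proved here.

References: T. Bałaban, CMP 99 (1985) 389–434 [Balaban1985BackgroundPropagators] ((3.3) p.390, (3.35) p.396, Thm 3.11 p.416); CMP 95 (1984) 17–40 [Balaban1984PropagatorsI]
((1.29)-(1.31) p.23); CMP 102 (1985) 277–309 [Balaban1985Variational] (Prop. 7 p.299).
-/

set_option autoImplicit false

noncomputable section

open scoped BigOperators Matrix.Norms.L2Operator Matrix

namespace Summit.QuantumFields.YangMills.Theorems.Prop7LemmaHCurvedOfPairRow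

open Literature.MathematicalPhysics.QuantumFieldTheory.Balaban1983to89
open Literature.MathematicalPhysics.QuantumFieldTheory.Balaban1983to89.T3ContinuumYM3Torus
open B9Eq39Adjoint (R covD divB)
open B9TorusCalculus (torusT)
open B10Eq27TorusAxialLog (unitsField toUField)
open B5Eq118OneStroke (iterBlockOf)
open B15DeterminingSets (embIter)
open Summit.QuantumFields.YangMills.Theorems.Prop7CovHodgeSplit (unitsField_toUField_mem_unitary)
open Summit.QuantumFields.YangMills.Theorems.Prop7LemmaHCurvedOfRows (lemmaH_curved_of_rows bicontr_of_mem_unitary)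
open Summit.QuantumFields.YangMills.Theorems.Prop7HermiteCornerDataRow (dataRow_lowerCorner)

/-- ★★★ **LEMMA-H-CURVED FROM FRAME ROWS AND A PAIR ROW AT THE CENTRES** (T³ letters; see the module docstring).
[cite: Balaban1985BackgroundPropagators, (3.3) p.390, (3.35) p.396, Thm 3.11 p.416; Balaban1984PropagatorsI, (1.29)-(1.31) p.23; Balaban1985Variational, Prop. 7 p.299] -/
theorem lemmaH_curved_of_pairRow (F : T3Family) (K n : ℕ) (hk : K - n ≤ (F.P K).m + (F.P K).K) (hℓ2 : 2 ≤ (F.P K).L ^ (K - n))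
    (W : GaugeField (F.P K) 0 (Matrix.specialUnitaryGroup (Fin 2) ℂ)) (ψ : Site (F.P K) 0 → Matrix (Fin 2) (Fin 2) ℂ)
    (hψ : ∀ x : Site (F.P K) 0, x ∉ Set.range (embIter (K - n)) →
      divB (torusT (F.P K) 0) (fun κ z => unitsField (toUField W) ⟨z, κ⟩) (fun κ y => covD (torusT (F.P K) 0) (fun κ z => unitsField (toUField W) ⟨z, κ⟩) κ
        (fun z => divB (torusT (F.P K) 0) (fun κ z => unitsField (toUField W) ⟨z, κ⟩)
          (fun ν w => covD (torusT (F.P K) 0) (fun κ z => unitsField (toUField W) ⟨z, κ⟩) ν ψ w) z) y) x = 0)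
    (Fr : Site (F.P K) (K - n) → Site (F.P K) 0 → (Matrix (Fin 2) (Fin 2) ℂ)ˣ)
    (hFr : ∀ y z, ‖(Fr y z : Matrix (Fin 2) (Fin 2) ℂ)‖ ≤ 1 ∧ ‖(((Fr y z)⁻¹ : (Matrix (Fin 2) (Fin 2) ℂ)ˣ) : Matrix (Fin 2) (Fin 2) ℂ)‖ ≤ 1)
    (hFr1 : ∀ y, Fr y (embIter (K - n) y) = 1)
    (c : Site (F.P K) (K - n) → Matrix (Fin 2) (Fin 2) ℂ) (hc : ∀ y (a : Matrix (Fin 2) (Fin 2) ℂ), Commute (c y) a) {a₀ : ℝ} (ha₀ : 0 ≤ a₀) (a₁ : ℝ)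
    (hA : ∀ (y : Site (F.P K) (K - n)) (z : Site (F.P K) 0),
      (∀ ν : Fin (F.P K).d, (y ν = (iterBlockOf (K - n) (fun κ => z κ - (((((F.P K).L ^ (K - n) - 1) / 2 : ℕ)) : ZMod ((F.P K).sitesPerDir 0)))) ν - 1 ∨ y ν = (iterBlockOf (K - n) (fun κ => z κ - (((((F.P K).L ^ (K - n) - 1) / 2 : ℕ)) : ZMod ((F.P K).sitesPerDir 0)))) ν ∨ y ν = (iterBlockOf (K - n) (fun κ => z κ - (((((F.P K).L ^ (K - n) - 1) / 2 : ℕ)) : ZMod ((F.P K).sitesPerDir 0)))) ν + 1 ∨ y ν = (iterBlockOf (K - n) (fun κ => z κ - (((((F.P K).L ^ (K - n) - 1) / 2 : ℕ)) : ZMod ((F.P K).sitesPerDir 0)))) ν + 2)) →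
      ∀ μ : Fin (F.P K).d,
        ‖(((Fr y z)⁻¹ * unitsField (toUField W) ⟨z, μ⟩ * Fr y (torusT (F.P K) 0 μ z) : (Matrix (Fin 2) (Fin 2) ℂ)ˣ) : Matrix (Fin 2) (Fin 2) ℂ) - 1‖ ≤ a₀
        ∧ ‖(((Fr y ((torusT (F.P K) 0 μ).symm z))⁻¹ * unitsField (toUField W) ⟨(torusT (F.P K) 0 μ).symm z, μ⟩ * Fr y z : (Matrix (Fin 2) (Fin 2) ℂ)ˣ) :
            Matrix (Fin 2) (Fin 2) ℂ) - 1‖ ≤ a₀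
        ∧ ‖(((Fr y z)⁻¹ * unitsField (toUField W) ⟨z, μ⟩ * Fr y (torusT (F.P K) 0 μ z) : (Matrix (Fin 2) (Fin 2) ℂ)ˣ) : Matrix (Fin 2) (Fin 2) ℂ)
            - (((Fr y ((torusT (F.P K) 0 μ).symm z))⁻¹ * unitsField (toUField W) ⟨(torusT (F.P K) 0 μ).symm z, μ⟩ * Fr y z : (Matrix (Fin 2) (Fin 2) ℂ)ˣ) :
              Matrix (Fin 2) (Fin 2) ℂ)‖ ≤ a₁)
    (D : Site (F.P K) (K - n) → ℝ)
    (hD : ∀ (y y₀ : Site (F.P K) (K - n)), (∀ ν : Fin (F.P K).d, (y ν = y₀ ν - 1 ∨ y ν = y₀ ν ∨ y ν = y₀ ν + 1 ∨ y ν = y₀ ν + 2)) →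
      ‖R (Fr y (embIter (K - n) y₀)) (ψ (embIter (K - n) y)) - ψ (embIter (K - n) y₀)‖ ≤ D y) :
    (F.L : ℝ) ^ (K - n) * ∑ x : Site (F.P K) 0, ∑ a : Fin 2, ∑ b : Fin 2,
        Complex.normSq ((divB (torusT (F.P K) 0) (fun κ z => unitsField (toUField W) ⟨z, κ⟩)
          (fun κ y => covD (torusT (F.P K) 0) (fun κ z => unitsField (toUField W) ⟨z, κ⟩) κ ψ y) x) a b)
      ≤ (F.L : ℝ) ^ (K - n) * (2 * ((3 * (2 * ((F.P K).d : ℝ) * (a₁ + 2 * a₀ ^ 2)) ^ 2 * ((((F.P K).L ^ (K - n) : ℕ) : ℝ)) ^ (F.P K).d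
          + 48 * ((F.P K).d : ℝ) ^ 2 * a₀ ^ 2 * (6 / ((((F.P K).L ^ (K - n) : ℕ) : ℝ)))
            * (6 / ((((F.P K).L ^ (K - n) : ℕ) : ℝ)) * ((((F.P K).L ^ (K - n) : ℕ) : ℝ)) ^ (F.P K).d)) * ∑ y : Site (F.P K) (K - n), ‖ψ (embIter (K - n) y) - c y‖ ^ 2
        + 3 * ((F.P K).d : ℝ) ^ 2 * (24 / ((((F.P K).L ^ (K - n) : ℕ) : ℝ)) ^ 2)
            * (24 / ((((F.P K).L ^ (K - n) : ℕ) : ℝ)) ^ 2 * ((((F.P K).L ^ (K - n) : ℕ) : ℝ)) ^ (F.P K).d)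
            * ∑ y : Site (F.P K) (K - n), (D y + 2 * (((F.P K).d : ℝ) * (((((F.P K).L ^ (K - n) : ℕ) : ℝ)) * (a₀ + a₀))) * ‖ψ (embIter (K - n) y) - c y‖) ^ 2)) := by
  have hU : ∀ (κ : Fin (F.P K).d) (z : Site (F.P K) 0), ‖((unitsField (toUField W) ⟨z, κ⟩ : (Matrix (Fin 2) (Fin 2) ℂ)ˣ) : Matrix (Fin 2) (Fin 2) ℂ)‖ ≤ 1
      ∧ ‖(((unitsField (toUField W) ⟨z, κ⟩)⁻¹ : (Matrix (Fin 2) (Fin 2) ℂ)ˣ) : Matrix (Fin 2) (Fin 2) ℂ)‖ ≤ 1 :=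
    fun κ z => bicontr_of_mem_unitary _ (unitsField_toUField_mem_unitary W κ z)
  have hA0 : ∀ (y : Site (F.P K) (K - n)) (w : Site (F.P K) 0),
      (∀ ν : Fin (F.P K).d, (y ν = (iterBlockOf (K - n) (fun κ => w κ - (((((F.P K).L ^ (K - n) - 1) / 2 : ℕ)) : ZMod ((F.P K).sitesPerDir 0)))) ν - 1 ∨ y ν = (iterBlockOf (K - n) (fun κ => w κ - (((((F.P K).L ^ (K - n) - 1) / 2 : ℕ)) : ZMod ((F.P K).sitesPerDir 0)))) ν ∨ y ν = (iterBlockOf (K - n) (fun κ => w κ - (((((F.P K).L ^ (K - n) - 1) / 2 : ℕ)) : ZMod ((F.P K).sitesPerDir 0)))) ν + 1 ∨ y ν = (iterBlockOf (K - n) (fun κ => w κ - (((((F.P K).L ^ (K - n) - 1) / 2 : ℕ)) : ZMod ((F.P K).sitesPerDir 0)))) ν + 2)) →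
      ∀ μ : Fin (F.P K).d,
        ‖(((Fr y w)⁻¹ * unitsField (toUField W) ⟨w, μ⟩ * Fr y (torusT (F.P K) 0 μ w) : (Matrix (Fin 2) (Fin 2) ℂ)ˣ) : Matrix (Fin 2) (Fin 2) ℂ) - 1‖ ≤ a₀ :=
    fun y w hN μ => (hA y w hN μ).1
  have hG := fun (y : Site (F.P K) (K - n)) (z : Site (F.P K) 0)
      (hN : ∀ ν : Fin (F.P K).d, (y ν = (iterBlockOf (K - n) (fun κ => z κ - (((((F.P K).L ^ (K - n) - 1) / 2 : ℕ)) : ZMod ((F.P K).sitesPerDir 0)))) ν - 1 ∨ y ν = (iterBlockOf (K - n) (fun κ => z κ - (((((F.P K).L ^ (K - n) - 1) / 2 : ℕ)) : ZMod ((F.P K).sitesPerDir 0)))) ν ∨ y ν = (iterBlockOf (K - n) (fun κ => z κ - (((((F.P K).L ^ (K - n) - 1) / 2 : ℕ)) : ZMod ((F.P K).sitesPerDir 0)))) ν + 1 ∨ y ν = (iterBlockOf (K - n) (fun κ => z κ - (((((F.P K).L ^ (K - n) - 1) / 2 : ℕ)) : ZMod ((F.P K).sitesPerDir 0)))) ν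 + 2)) (_μ : Fin (F.P K).d) =>
    dataRow_lowerCorner (P := F.P K) (k := K - n) hk (fun κ z => unitsField (toUField W) ⟨z, κ⟩) hU Fr hFr hFr1 (fun y => ψ (embIter (K - n) y)) c hc ha₀
      hA0 D hD y z hN
  exact lemmaH_curved_of_rows F K n hk hℓ2 W ψ hψ Fr hFr hFr1 c hc a₀ a₁ hA
    (fun _ z => R (Fr (iterBlockOf (K - n) (fun κ => z κ - (((((F.P K).L ^ (K - n) - 1) / 2 : ℕ)) : ZMod ((F.P K).sitesPerDir 0)))) z) (ψ (embIter (K - n) (iterBlockOf (K - n) (fun κ => z κ - (((((F.P K).L ^ (K - n) - 1) / 2 : ℕ)) : ZMod ((F.P K).sitesPerDir 0))))))) _ hG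

end Summit.QuantumFields.YangMills.Theorems.Prop7LemmaHCurvedOfPairRow

end
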